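import Mathlib
import Summits.ValiantsHypothesis.ValiantsHypothesis.Theorems.NewtonUnitEquationsNewtonTauWeakMedianSplitting
import Summits.ValiantsHypothesis.ValiantsHypothesis.Theorems.NewtonUnitEquationsNewtonTauWeakCoreLogBound

/-!
# The uniform base bound for `c`-core designs (crux `NewtonTauWeak`, three-bin law task)

`coreChart_medianBound`: a design on `c ≥ 1` cores, read through any `V ⊆ Fin x` with `|V| < 2^k`, has at most
`(2c)^k · 9^{|V|}` lower-hull vertices (chart points, `σ = -1`).  With `k = ⌊log₂ x⌋ + 1` this is per-element base
`9` with a factor polynomial in `x` — UNIFORMLY IN THE NUMBER OF CORES `c` (the Minkowski splitting along cores,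
`coreChart_logBound`, gives base `1 + ⌈log₂ c⌉`).  Proof: induction on `k`; the step is the median-layer splitting
recursion `MedianSplittingAux.chart_ncard_le_sum_median` (both sub-designs of every one of the `≤ c·3^{|V|}` data live
on at most `⌊|V|/2⌋ < 2^{k-1}` elements) and the arithmetic `c·3^n·2·(2c)^{k}·9^{⌊n/2⌋} ≤ (2c)^{k+1}·9^n`.
-/

-- Sub = Summit single-conjunct layout: the duplicated namespace component is mandated by the tree.
set_option linter.dupNamespace false

open scoped BigOperators

namespace Summit.ValiantsHypothesis.ValiantsHypothesis.Theorems.NewtonUnitEquationsNewtonTauWeak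

namespace MedianBoundAux

/-- The median data `(m, T, T')`, `T ⊆ T' ⊆ V`, number at most `c · 3^{|V|}` (whatever the filter). [folklore] -/
theorem card_data_le (x c : ℕ) (V : Finset (Fin x)) (p : Fin c × (Finset (Fin x) × Finset (Fin x)) → Prop)
    [DecidablePred p] :
    ((Finset.univ ×ˢ V.powerset.biUnion fun T' => T'.powerset.image fun T => (T, T')).filter p).card ≤
      c * 3 ^ V.card := by
  refine (Finset.card_filter_le _ _).trans ?_
  rw [Finset.card_product, Finset.card_univ, Fintype.card_fin]
  refine Nat.mul_le_mul_left c (Finset.card_biUnion_le.trans ?_)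
  calc ∑ T' ∈ V.powerset, (T'.powerset.image fun T => (T, T')).card
      ≤ ∑ T' ∈ V.powerset, 2 ^ T'.card :=
        Finset.sum_le_sum fun T' _ => Finset.card_image_le.trans (by rw [Finset.card_powerset])
    _ = 3 ^ V.card := CoreLogBoundAux.sum_pow_card x 2 V

/-- Arithmetic of the induction step: `c·3^n·(2·((2c)^k·9^{⌊n/2⌋})) ≤ (2c)^{k+1}·9^n`. [folklore] -/
theorem step_arith (c k n : ℕ) : c * 3 ^ n * (2 * ((2 * c) ^ k * 9 ^ (n / 2))) ≤ (2 * c) ^ (k + 1) * 9 ^ n := by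
  have h1 : 9 ^ (n / 2) ≤ 3 ^ n :=
    calc 9 ^ (n / 2) = 3 ^ (2 * (n / 2)) := by rw [pow_mul]; norm_num
      _ ≤ 3 ^ n := Nat.pow_le_pow_right (by norm_num) (Nat.mul_div_le n 2)
  have h2 : 3 ^ n * 9 ^ (n / 2) ≤ 9 ^ n :=
    calc 3 ^ n * 9 ^ (n / 2) ≤ 3 ^ n * 3 ^ n := Nat.mul_le_mul_left _ h1
      _ = 9 ^ n := by rw [← mul_pow]; norm_num
  calc c * 3 ^ n * (2 * ((2 * c) ^ k * 9 ^ (n / 2))) = (2 * c) ^ (k + 1) * (3 ^ n * 9 ^ (n / 2)) := by ring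
    _ ≤ (2 * c) ^ (k + 1) * 9 ^ n := Nat.mul_le_mul_left _ h2

variable {x c : ℕ}

/-- A cloud read through the empty set is a single point, so it has at most one chart point. [folklore] -/
theorem ncard_chart_le_one (h : Fin c → Finset (Fin x) → (Fin 2 →₀ ℕ))
    (cl : Finset (Fin c) → Finset (Fin x) → (Fin 2 →₀ ℕ) → Finset (Fin 2 →₀ ℕ))
    (hcl : ∀ D V a, cl D V a = ((Finset.univ.filter fun f : Fin x → Fin c => ∀ u ∈ V, f u ∈ D).image
        fun f => a + ∑ d ∈ D, h d (V ∩ Finset.univ.filter fun u => f u = d)))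
    (ch : Finset (Fin 2 →₀ ℕ) → Set (Fin 2 →₀ ℕ))
    (hch : ∀ S, ch S = {p : Fin 2 →₀ ℕ | p ∈ S ∧ ∃ t : ℝ, ∀ q ∈ S, q ≠ p →
        t * ((q 0 : ℕ) : ℝ) + (-1) * ((q 1 : ℕ) : ℝ) < t * ((p 0 : ℕ) : ℝ) + (-1) * ((p 1 : ℕ) : ℝ)})
    (D : Finset (Fin c)) (V : Finset (Fin x)) (a : Fin 2 →₀ ℕ) (hV : V.card = 0) :
    (ch (cl D V a)).ncard ≤ 1 := by
  rw [Finset.card_eq_zero] at hV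
  subst hV
  rw [hch]
  calc {p : Fin 2 →₀ ℕ | p ∈ cl D ∅ a ∧ ∃ t : ℝ, ∀ q ∈ cl D ∅ a, q ≠ p →
        t * ((q 0 : ℕ) : ℝ) + (-1) * ((q 1 : ℕ) : ℝ) < t * ((p 0 : ℕ) : ℝ) + (-1) * ((p 1 : ℕ) : ℝ)}.ncard
      ≤ (cl D ∅ a : Set (Fin 2 →₀ ℕ)).ncard := Set.ncard_le_ncard (fun p hp => hp.1) (Finset.finite_toSet _)
    _ = (cl D ∅ a).card := Set.ncard_coe_finset _
    _ ≤ 1 := by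
      rw [hcl]
      refine Finset.card_le_one.mpr fun p hp q hq => ?_
      obtain ⟨f, -, rfl⟩ := Finset.mem_image.mp hp
      obtain ⟨g, -, rfl⟩ := Finset.mem_image.mp hq
      simp only [Finset.empty_inter]

/-- **THE INDUCTION.**  For `c ≥ 1`: a cloud read through `V` with `|V| < 2^k` (any allowed bins, any offset) has at most
`(2c)^k · 9^{|V|}` chart points. [folklore] -/
theorem median_bound (hc : 1 ≤ c) (h : Fin c → Finset (Fin x) → (Fin 2 →₀ ℕ))
    (cl : Finset (Fin c) → Finset (Fin x) → (Fin 2 →₀ ℕ) → Finset (Fin 2 →₀ ℕ))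
    (hcl : ∀ D V a, cl D V a = ((Finset.univ.filter fun f : Fin x → Fin c => ∀ u ∈ V, f u ∈ D).image
        fun f => a + ∑ d ∈ D, h d (V ∩ Finset.univ.filter fun u => f u = d)))
    (ch : Finset (Fin 2 →₀ ℕ) → Set (Fin 2 →₀ ℕ))
    (hch : ∀ S, ch S = {p : Fin 2 →₀ ℕ | p ∈ S ∧ ∃ t : ℝ, ∀ q ∈ S, q ≠ p →
        t * ((q 0 : ℕ) : ℝ) + (-1) * ((q 1 : ℕ) : ℝ) < t * ((p 0 : ℕ) : ℝ) + (-1) * ((p 1 : ℕ) : ℝ)})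
    (k : ℕ) : ∀ (D : Finset (Fin c)) (V : Finset (Fin x)) (a : Fin 2 →₀ ℕ), V.card < 2 ^ k →
      (ch (cl D V a)).ncard ≤ (2 * c) ^ k * 9 ^ V.card := by
  induction k with
  | zero =>
    intro D V a hV
    have hV0 : V.card = 0 := by omega
    rw [hV0]
    simpa using ncard_chart_le_one h cl hcl ch hch D V a hV0
  | succ k ih =>
    intro D V a hV
    rcases Nat.eq_zero_or_pos V.card with hV0 | hVpos
    · rw [hV0, pow_zero, mul_one]
      exact (ncard_chart_le_one h cl hcl ch hch D V a hV0).trans (Nat.one_le_pow _ _ (by omega))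
    -- the recursion at `kk = ⌈|V|/2⌉`
    set n := V.card with hn
    have hkk1 : 1 ≤ (n + 1) / 2 := by omega
    have hkkV : (n + 1) / 2 ≤ V.card := by omega
    refine (MedianSplittingAux.chart_ncard_le_sum_median h cl hcl ch hch D V a hkk1 hkkV).trans ?_
    -- every summand is at most `2 · (2c)^k · 9^{⌊n/2⌋}` by the induction hypothesis
    have hbound : ∀ σ ∈ (Finset.univ ×ˢ V.powerset.biUnion fun T' => T'.powerset.image fun T => (T, T')).filter
        (fun σ : Fin c × (Finset (Fin x) × Finset (Fin x)) =>
          σ.1 ∈ D ∧ σ.2.1.card < (n + 1) / 2 ∧ (n + 1) / 2 ≤ σ.2.2.card),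
        (ch (cl (D.filter fun d => d < σ.1) σ.2.1 (a + h σ.1 (σ.2.2 \ σ.2.1)))).ncard +
            (ch (cl (D.filter fun d => σ.1 < d) (V \ σ.2.2) 0)).ncard ≤
          2 * ((2 * c) ^ k * 9 ^ (n / 2)) := by
      rintro ⟨m, T, T'⟩ hσ
      simp only [Finset.mem_filter, Finset.mem_product, Finset.mem_univ, true_and, Finset.mem_biUnion,
        Finset.mem_powerset, Finset.mem_image, Prod.mk.injEq] at hσ
      obtain ⟨⟨T₂, hT'V, T₁, -, hTeq, hT'eq⟩, -, hTk, hkT'⟩ := hσ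
      subst hTeq hT'eq
      have hA : (ch (cl (D.filter fun d => d < m) T₁ (a + h m (T₂ \ T₁)))).ncard ≤ (2 * c) ^ k * 9 ^ (n / 2) :=
        (ih _ T₁ _ (by omega)).trans
          (Nat.mul_le_mul_left _ (Nat.pow_le_pow_right (by norm_num) (by omega)))
      have hcard : (V \ T₂).card = n - T₂.card := by rw [Finset.card_sdiff_of_subset hT'V]
      have hB : (ch (cl (D.filter fun d => m < d) (V \ T₂) 0)).ncard ≤ (2 * c) ^ k * 9 ^ (n / 2) :=
        (ih _ (V \ T₂) _ (by rw [hcard]; omega)).trans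
          (Nat.mul_le_mul_left _ (Nat.pow_le_pow_right (by norm_num) (by rw [hcard]; omega)))
      calc _ ≤ (2 * c) ^ k * 9 ^ (n / 2) + (2 * c) ^ k * 9 ^ (n / 2) := Nat.add_le_add hA hB
        _ = 2 * ((2 * c) ^ k * 9 ^ (n / 2)) := by ring
    refine (Finset.sum_le_sum hbound).trans ?_
    rw [Finset.sum_const, smul_eq_mul]
    exact (Nat.mul_le_mul_right _ (card_data_le x c V _)).trans (step_arith c k n)

end MedianBoundAux

/-- **Uniform base bound (median-layer splitting iterated).**  For `1 ≤ c`, every design `h` on `c` cores and every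
`V ⊆ Fin x` with `|V| < 2^k`: the lower-hull vertices (`σ = -1` chart points) of the cloud of all configurations read
through `V` number at most `(2c)^k · 9^{|V|}` — per-element base `9` with a factor `(2c)^{⌊log₂|V|⌋+1}`, uniformly in
the number of cores (compare `coreChart_logBound`: base `1 + ⌈log₂ c⌉`). [folklore] -/
theorem coreChart_medianBound (x c k : ℕ) (hc : 1 ≤ c) (V : Finset (Fin x)) (hV : V.card < 2 ^ k)
    (h : Fin c → Finset (Fin x) → (Fin 2 →₀ ℕ)) :
    {p : Fin 2 →₀ ℕ | p ∈ (Finset.univ.image fun f : Fin x → Fin c =>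
          ∑ d, h d (V ∩ Finset.univ.filter fun u => f u = d)) ∧
        ∃ t : ℝ, ∀ q ∈ (Finset.univ.image fun f : Fin x → Fin c =>
          ∑ d, h d (V ∩ Finset.univ.filter fun u => f u = d)), q ≠ p →
          t * ((q 0 : ℕ) : ℝ) + (-1) * ((q 1 : ℕ) : ℝ) < t * ((p 0 : ℕ) : ℝ) + (-1) * ((p 1 : ℕ) : ℝ)}.ncard ≤
      (2 * c) ^ k * 9 ^ V.card := by
  have e : ((Finset.univ.filter fun f : Fin x → Fin c => ∀ u ∈ V, f u ∈ (Finset.univ : Finset (Fin c))).image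
      fun f => (0 : Fin 2 →₀ ℕ) + ∑ d ∈ Finset.univ, h d (V ∩ Finset.univ.filter fun u => f u = d)) =
      Finset.univ.image fun f : Fin x → Fin c => ∑ d, h d (V ∩ Finset.univ.filter fun u => f u = d) := by
    rw [Finset.filter_true_of_mem fun f _ u _ => Finset.mem_univ (f u)]
    simp only [zero_add]
  obtain ⟨cl, hcl⟩ : ∃ cl : Finset (Fin c) → Finset (Fin x) → (Fin 2 →₀ ℕ) → Finset (Fin 2 →₀ ℕ), ∀ D V a,
      cl D V a = ((Finset.univ.filter fun f : Fin x → Fin c => ∀ u ∈ V, f u ∈ D).image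
        fun f => a + ∑ d ∈ D, h d (V ∩ Finset.univ.filter fun u => f u = d)) := ⟨_, fun _ _ _ => rfl⟩
  obtain ⟨ch, hch⟩ : ∃ ch : Finset (Fin 2 →₀ ℕ) → Set (Fin 2 →₀ ℕ), ∀ S,
      ch S = {p : Fin 2 →₀ ℕ | p ∈ S ∧ ∃ t : ℝ, ∀ q ∈ S, q ≠ p →
        t * ((q 0 : ℕ) : ℝ) + (-1) * ((q 1 : ℕ) : ℝ) < t * ((p 0 : ℕ) : ℝ) + (-1) * ((p 1 : ℕ) : ℝ)} :=
    ⟨_, fun _ => rfl⟩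
  have key := MedianBoundAux.median_bound hc h cl hcl ch hch k Finset.univ V 0 hV
  rw [hch, hcl, e] at key
  exact key

end Summit.ValiantsHypothesis.ValiantsHypothesis.Theorems.NewtonUnitEquationsNewtonTauWeak
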